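import Mathlib.MeasureTheory.Function.LpSeminorm.CompareExp
import Summits.NavierStokesRegularity.NavierStokesRegularity.Theorems.RecurrentProfilesRecurrentReductionOrbit
import Summits.NavierStokesRegularity.NavierStokesRegularity.Theorems.SqueezeCycleRecurrentLiouvilleGkWindowIncrementRemoval
import Literature.Analysis.FluidPDE.SelfSimilar
import HarnessLib

/-!
# Crux `RecurrentLiouville` (stmt-NavierStokesRegularity-1589), line `Sketch` (v6, Giga–Kohn harvest) —
# stub `stub_gkOrbitSpeedL3`: the orbit speed law in `L³`

Theorems-only file (no definitions, no named facts).  **Orbit speed law.**  For every rate `C` and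
bound `M < ⊤` there are `R > 0` and `δ > 0` such that, for every suitable weak solution `(u, p)` of
Navier–Stokes (`ν = 1`) on `ℝ³ × ℝ₋` with weak gradient `G`, Albritton–Barker quantity `𝐈 ≤ M`,
the Type-I rate `‖u(t,x)‖ ≤ C/√(−t)` and a backward-singular origin, and for every log-scale `a`,
the scaling orbit `σ ↦ (u_{e^a})_{e^σ}` of the zoom `u_{e^a} = nsRescale (exp a) u` moves by MORE
than `δ` in `L³([−2,−1] × B̄_R)` within log-scale `σ ∈ [0, (log 2)/2]`.

This is the landed WINDOW INCREMENT REMOVAL theorem `stub_gkWindowIncrementRemoval` (S1) read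
contrapositively along the whole orbit: the zoom `u_{e^a}` is again a singular Type-I slab profile
of the same class (`zoom_slabProfile`, `HasTypeITimeDecay.nsRescale`,
`isBackwardSingularPoint_zoom`), so by S1 some scale factor `1 ≤ c ≤ √2` has
`∫_{(−2,−1)×B_R} ‖c v(c²t, cx) − v(t,x)‖² > δ₀`; writing `c = e^σ` and converting `L²` on the open
box to `L³` on the compact box by Hölder (`eLpNorm_le_eLpNorm_mul_rpow_measure_univ`) gives the
claim with `δ := √δ₀ / (|K|^{1/6} + 1)`.

## References

* T.-P. Tsai, Arch. Rational Mech. Anal. 143 (1998), Thm 1. [Tsai1998]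
* D. Albritton, T. Barker, J. Math. Fluid Mech. 21 (2019), Lemma 2.2, Prop. 2.3, §3. [AlbrittonBarker2019]
-/

noncomputable section

-- the sub-problem namespace repeats the summit name (D-0017 layout `Summit.<S>.<P>.Theorems`)
set_option linter.dupNamespace false

namespace Summit.NavierStokesRegularity.NavierStokesRegularity.Theorems

open MeasureTheory Set Function Filter Topology TopologicalSpace Metric
open Literature.Analysis Literature.Analysis.FluidPDE
open scoped NNReal ENNReal

/-! ### Tools -/

/-- **Hölder, `L² ⊂ L³` on a set of finite measure**:
`∫ ‖f‖ₑ² dμ ≤ (‖f‖_{L³(μ)} μ(univ)^{1/6})²`. [folklore] -/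
theorem gkSpeed_lintegral_enorm_sq_le {α F : Type*} [MeasurableSpace α] {μ : Measure α}
    [NormedAddCommGroup F] {f : α → F} (hf : AEStronglyMeasurable f μ) :
    ∫⁻ x, ‖f x‖ₑ ^ 2 ∂μ ≤ (eLpNorm f 3 μ * μ univ ^ (1 / 6 : ℝ)) ^ 2 := by
  -- adapted from `lintegral_enorm_sq_le_sq_eLpNorm_mul` (Literature/Analysis/FluidPDE/AlbrittonKatoClassLocalLeray)
  have h2 : ∫⁻ x, ‖f x‖ₑ ^ 2 ∂μ = eLpNorm f 2 μ ^ 2 := by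
    have h := eLpNorm_nnreal_pow_eq_lintegral (f := f) (μ := μ) (p := (2 : ℝ≥0)) (by norm_num)
    rw [show ((2 : ℝ≥0) : ℝ) = ((2 : ℕ) : ℝ) by norm_num,
      show ((2 : ℝ≥0) : ℝ≥0∞) = 2 by norm_num] at h
    simp_rw [ENNReal.rpow_natCast] at h
    exact h.symm
  rw [h2]
  have h := eLpNorm_le_eLpNorm_mul_rpow_measure_univ (p := 2) (q := 3) (μ := μ) (by norm_num) hf
  rw [show (1 / (2 : ℝ≥0∞).toReal - 1 / (3 : ℝ≥0∞).toReal : ℝ) = 1 / 6 by norm_num] at h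
  gcongr

/-- Orbit points `u_c = c u(c²·, c·)` (`c > 0`) of a slab profile with a weak gradient are
a.e.-strongly measurable on every subset of the open backward slab. [folklore] -/
theorem gkSpeed_aestronglyMeasurable_nsRescale
    {u : ℝ → EuclideanSpace ℝ (Fin 3) → EuclideanSpace ℝ (Fin 3)}
    {G : ℝ → EuclideanSpace ℝ (Fin 3) → EuclideanSpace ℝ (Fin 3) →L[ℝ] EuclideanSpace ℝ (Fin 3)}
    (hwg : HasWeakSpatialGradientOn (slab (EuclideanSpace ℝ (Fin 3)) (Iio 0) isOpen_Iio) u G)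
    {c : ℝ} (hc : 0 < c) {S : Set (ℝ × EuclideanSpace ℝ (Fin 3))}
    (hS : S ⊆ Iio (0 : ℝ) ×ˢ (univ : Set (EuclideanSpace ℝ (Fin 3)))) :
    AEStronglyMeasurable (uncurry (nsRescale c u)) (volume.restrict S) := by
  have h := zoom_hasWeakSpatialGradientOn hwg hc 0 0
  rw [stPreimage_slab_eq hc, ← nsRescale_eq_zoom] at h
  exact h.locallyIntegrableOn.aestronglyMeasurable.mono_measure (Measure.restrict_mono hS le_rfl)

/-- A scale factor `1 ≤ c`, `c² ≤ 2` has log-scale `log c ∈ [0, (log 2)/2]`. [folklore] -/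
theorem gkSpeed_log_mem_Icc {c : ℝ} (h1c : 1 ≤ c) (hc2 : c ^ 2 ≤ 2) :
    Real.log c ∈ Icc (0 : ℝ) (Real.log 2 / 2) := by
  have hc0 : 0 < c := one_pos.trans_le h1c
  refine ⟨Real.log_nonneg h1c, ?_⟩
  have h := Real.log_le_log (pow_pos hc0 2) hc2
  rw [Real.log_pow, Nat.cast_ofNat] at h
  linarith

/-! ### The orbit speed law -/

/-- **Orbit speed law in `L³`** (registered stub of crux stmt-NavierStokesRegularity-1589, line
Sketch v6 harvest).  For every rate `C` and bound `M < ⊤` there are `R > 0` and `δ > 0` such that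
along the whole scaling orbit of a Type-I singularity model (suitable weak solution on `ℝ³ × ℝ₋`
with weak gradient, `𝐈 ≤ M`, rate `C`, backward-singular origin), within log-scale `(log 2)/2`
the orbit moves by more than `δ` in `L³([−2,−1] × B̄_R)`: for every `a` some `σ ∈ [0, (log 2)/2]`
has `‖(u_{e^a})_{e^σ} − u_{e^a}‖_{L³([−2,−1]×B̄_R)} > δ`.  From the window increment removal S1
(`stub_gkWindowIncrementRemoval`) applied to the zoom `u_{e^a}` and Hölder.
[cite: Tsai1998, Thm 1; AlbrittonBarker2019, Lemma 2.2, Prop. 2.3 and §3] -/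
theorem stub_gkOrbitSpeedL3 :
    ∀ (C : ℝ) (M : ℝ≥0∞), M < ⊤ →
      ∃ R : ℝ, 0 < R ∧ ∃ δ : ℝ, 0 < δ ∧
        ∀ (u : ℝ → EuclideanSpace ℝ (Fin 3) → EuclideanSpace ℝ (Fin 3))
          (p : ℝ → EuclideanSpace ℝ (Fin 3) → ℝ)
          (G : ℝ → EuclideanSpace ℝ (Fin 3) → EuclideanSpace ℝ (Fin 3) →L[ℝ] EuclideanSpace ℝ (Fin 3)),
          IsSuitableWeakSolutionOn (slab (EuclideanSpace ℝ (Fin 3)) (Iio 0) isOpen_Iio) 1 0 u p →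
          HasWeakSpatialGradientOn (slab (EuclideanSpace ℝ (Fin 3)) (Iio 0) isOpen_Iio) u G →
          typeIBound (Iio (0 : ℝ) ×ˢ univ) u p G ≤ M →
          HasTypeITimeDecay C u →
          IsBackwardSingularPoint u 0 →
          ∀ a : ℝ, ∃ σ ∈ Set.Icc (0 : ℝ) (Real.log 2 / 2),
            ENNReal.ofReal δ <
              eLpNorm (fun z : ℝ × EuclideanSpace ℝ (Fin 3) =>
                  nsRescale (Real.exp σ) (nsRescale (Real.exp a) u) z.1 z.2 -
                    nsRescale (Real.exp a) u z.1 z.2) 3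
                (volume.restrict (Set.Icc (-2 : ℝ) (-1) ×ˢ
                  Metric.closedBall (0 : EuclideanSpace ℝ (Fin 3)) R)) := by
  intro C M hM
  obtain ⟨R, hR, δ₀, hδ₀, hS1⟩ := stub_gkWindowIncrementRemoval C M hM
  refine ⟨R, hR, ?_⟩
  -- the compact box `K = [-2,-1] × B̄_R` and the open box `(-2,-1) × B_R ⊆ K ⊆ {t < 0} × ℝ³`
  set K : Set (ℝ × EuclideanSpace ℝ (Fin 3)) :=
    Set.Icc (-2 : ℝ) (-1) ×ˢ Metric.closedBall (0 : EuclideanSpace ℝ (Fin 3)) R with hK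
  have hKc : IsCompact K := isCompact_Icc.prod (isCompact_closedBall _ _)
  have hKfin : volume K < ⊤ := hKc.measure_lt_top
  have hKslab : K ⊆ Iio (0 : ℝ) ×ˢ (univ : Set (EuclideanSpace ℝ (Fin 3))) :=
    prod_mono (fun t ht => mem_Iio.2 (by linarith [ht.2])) (subset_univ _)
  have hboxK : Ioo (-2 : ℝ) (-1) ×ˢ Metric.ball (0 : EuclideanSpace ℝ (Fin 3)) R ⊆ K :=
    prod_mono Ioo_subset_Icc_self ball_subset_closedBall
  have hVe : volume K ^ (1 / 6 : ℝ) ≠ ⊤ := ENNReal.rpow_ne_top_of_nonneg (by norm_num) hKfin.ne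
  obtain ⟨A, hA0, hVA⟩ : ∃ A : ℝ, 0 ≤ A ∧ volume K ^ (1 / 6 : ℝ) = ENNReal.ofReal A :=
    ⟨_, ENNReal.toReal_nonneg, (ENNReal.ofReal_toReal hVe).symm⟩
  -- the threshold `δ = √δ₀ / (A + 1)`: `(δ A)² ≤ δ₀`
  have hδ : 0 < Real.sqrt δ₀ / (A + 1) := by positivity
  have hfinal : (ENNReal.ofReal (Real.sqrt δ₀ / (A + 1)) * volume K ^ (1 / 6 : ℝ)) ^ 2 ≤
      ENNReal.ofReal δ₀ := by
    rw [hVA, ← ENNReal.ofReal_mul hδ.le, ← ENNReal.ofReal_pow (by positivity)]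
    refine ENNReal.ofReal_le_ofReal ?_
    have hδA : Real.sqrt δ₀ / (A + 1) * A ≤ Real.sqrt δ₀ := by
      rw [div_mul_eq_mul_div, div_le_iff₀ (by positivity)]
      exact mul_le_mul_of_nonneg_left (by linarith) (Real.sqrt_nonneg _)
    calc (Real.sqrt δ₀ / (A + 1) * A) ^ 2 ≤ Real.sqrt δ₀ ^ 2 :=
          pow_le_pow_left₀ (by positivity) hδA 2
      _ = δ₀ := Real.sq_sqrt hδ₀.le
  refine ⟨Real.sqrt δ₀ / (A + 1), hδ, ?_⟩
  intro u p G hsw hwg hI hdec hsing a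
  by_contra hcon
  push Not at hcon
  -- the zoom `v = u_{e^a}` is a singular Type-I slab profile of the same class
  have ha : 0 < Real.exp a := Real.exp_pos a
  have hv : nsRescale (Real.exp a) u =
      Real.exp a • stPull (Real.exp a ^ 2) (Real.exp a) (0 : ℝ) (0 : EuclideanSpace ℝ (Fin 3)) u :=
    nsRescale_eq_zoom _ _
  have hz := zoom_slabProfile hsw hwg ha
  rw [← hv] at hz
  have hsing' := isBackwardSingularPoint_zoom hsing ha
  rw [← hv] at hsing'
  refine hS1 _ _ _ hz.1 hz.2.1 (hz.2.2.le.trans hI) (hdec.nsRescale ha) (fun c h1c hc2 => ?_) hsing'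
  -- S1's window increment at the scale factor `c = e^σ`, `σ = log c ∈ [0, (log 2)/2]`
  have hc0 : 0 < c := one_pos.trans_le h1c
  have hle := hcon (Real.log c) (gkSpeed_log_mem_Icc h1c hc2)
  rw [Real.exp_log hc0] at hle
  have hmeas : AEStronglyMeasurable (fun z : ℝ × EuclideanSpace ℝ (Fin 3) =>
      nsRescale c (nsRescale (Real.exp a) u) z.1 z.2 - nsRescale (Real.exp a) u z.1 z.2)
      (volume.restrict K) := by
    have h1 := gkSpeed_aestronglyMeasurable_nsRescale hwg (mul_pos ha hc0) hKslab
    rw [nsRescale_mul] at h1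
    exact h1.sub (gkSpeed_aestronglyMeasurable_nsRescale hwg ha hKslab)
  calc ∫⁻ z in Ioo (-2 : ℝ) (-1) ×ˢ Metric.ball (0 : EuclideanSpace ℝ (Fin 3)) R,
        ‖nsRescale c (nsRescale (Real.exp a) u) z.1 z.2 - nsRescale (Real.exp a) u z.1 z.2‖ₑ ^ 2
      ≤ ∫⁻ z in K, ‖nsRescale c (nsRescale (Real.exp a) u) z.1 z.2 -
          nsRescale (Real.exp a) u z.1 z.2‖ₑ ^ 2 := lintegral_mono_set hboxK
    _ ≤ (eLpNorm (fun z : ℝ × EuclideanSpace ℝ (Fin 3) =>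
            nsRescale c (nsRescale (Real.exp a) u) z.1 z.2 - nsRescale (Real.exp a) u z.1 z.2) 3
            (volume.restrict K) * (volume.restrict K) univ ^ (1 / 6 : ℝ)) ^ 2 :=
        gkSpeed_lintegral_enorm_sq_le hmeas
    _ ≤ (ENNReal.ofReal (Real.sqrt δ₀ / (A + 1)) * volume K ^ (1 / 6 : ℝ)) ^ 2 := by
        rw [Measure.restrict_apply_univ]
        gcongr
    _ ≤ ENNReal.ofReal δ₀ := hfinal

end Summit.NavierStokesRegularity.NavierStokesRegularity.Theorems

end
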